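import Mathlib.Analysis.Complex.Order
import Mathlib.Analysis.Normed.Algebra.MatrixExponential
import Mathlib.Analysis.CStarAlgebra.Matrix
import Literature.MathematicalPhysics.QuantumLattice.GinibreDoubling
import HarnessLib

/-!
# Ginibre's doubled system for spin ½: BLU Lemmas 6–8 and the positivity mechanism (proofs)

Sibling proof file of `GinibreDoubling.lean` (no definition here; only theorems). We prove, in
the vocabulary defined there, the three lemmas of C. Benassi, B. Lees, D. Ueltschi,
*Correlation inequalities for the quantum XY model*, J. Stat. Phys. 164 (2016) = arXiv:1510.03215,
§3 (held, materialised p0005), and the positivity statement behind their Theorem 1: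

* entrywise nonnegative complex matrices (`∀ i j, 0 ≤ M i j` in Mathlib's `ComplexOrder`) are
  closed under `+`, `*`, nonnegative scalars, sums, powers and the matrix exponential
  (`entrywise_nonneg_exp`), and have nonnegative trace;
* the algebra of `a ⊗ 𝟙`, `𝟙 ⊗ b` (`dblLR_mul_dblLR`, `trace_dblLeft_mul_dblRight`, `dblLeft_exp`,
  `dblLeft_exp_mul_dblRight_exp`: `e^{a} ⊗ e^{a'} = e^{a ⊗ 𝟙 + 𝟙 ⊗ a'}`);
* **BLU Lemma 7** `(ab)_± = ½ a₊ b_± + ½ a₋ b_∓` (`dblPlus_mul`, `dblMinus_mul`);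
* **BLU Lemma 6** in trace form (`trace_dblMinus_mul_mul_dblMinus_mul`):
  `Tr[a₋ (W ⊗ W) b₋ (W' ⊗ W')] = 2 (Tr(aWbW') Tr(WW') - Tr(aWW') Tr(WbW'))`;
* **BLU Lemma 8**: in the basis `bluBasis` of `ℂ² ⊗ ℂ² ≅ ℂ⁴`, `σˣ₊, σˣ₋, σʸ₊` have nonnegative and
  `σʸ₋` nonpositive entries (explicit `4 × 4` computations), hence the same for the site
  operators `(Sˣ_x)_±`, `(Sʸ_x)_±` of the doubled system under `ginibreConj Λ = U · U†`,
  `U = ⨂_x bluBasis` (`entrywise_nonneg_ginibreConj_dblPlus_siteSpin_zero`, …);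
* **the positivity mechanism of BLU's proof of Theorem 1** (`ginibre_trace_sub_nonneg`): if
  `U A₊ U†, U a₋ U†, U b₋ U† ≥ 0` entrywise then for `c, d ≥ 0`
  `Tr(a e^{cA} b e^{dA}) Tr(e^{cA} e^{dA}) - Tr(a e^{cA} e^{dA}) Tr(e^{cA} b e^{dA}) ≥ 0`
  (BLU expand the exponential in its Taylor series; here: the exponential of an entrywise
  nonnegative matrix is entrywise nonnegative, and `U e^{X} U† = e^{U X U†}`);
* Ginibre's cone (`a₊, a₋ ≥ 0` in the good basis) is closed under products, sums and nonnegative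
  scalars and contains the `Sˣ_x` (`ginibreCone_mul`, …, `ginibreCone_siteSpin_zero`).

The application to Gibbs states of the XY model (BLU Thm. 1 / Cor. 2) is in
`XYGriffithsBLUProofs.lean`.

## References

* C. Benassi, B. Lees, D. Ueltschi, J. Stat. Phys. 164 (2016) 1157 = arXiv:1510.03215, §3,
  Lemmas 6, 7, 8 and the proof of Theorem 1. [BenassiLeesUeltschi2016]
* J. Ginibre, Comm. Math. Phys. 16 (1970) 310–328. [Ginibre1970]
-/

noncomputable section

namespace Literature.MathematicalPhysics.QuantumLattice

open Matrix Complex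
open scoped Kronecker ComplexOrder

/-! ### Entrywise nonnegative complex matrices -/

section EntrywiseNonneg

variable {n : Type*} [Fintype n] [DecidableEq n]

omit [DecidableEq n] in
/-- Products of entrywise nonnegative matrices are entrywise nonnegative. [folklore] -/
theorem entrywise_nonneg_mul {A B : Matrix n n ℂ} (hA : ∀ i j, 0 ≤ A i j) (hB : ∀ i j, 0 ≤ B i j) :
    ∀ i j, 0 ≤ (A * B) i j := fun i j => by
  rw [Matrix.mul_apply]
  exact Finset.sum_nonneg fun k _ => mul_nonneg (hA i k) (hB k j)

omit [Fintype n] [DecidableEq n] in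
/-- Sums of entrywise nonnegative matrices are entrywise nonnegative. [folklore] -/
theorem entrywise_nonneg_add {A B : Matrix n n ℂ} (hA : ∀ i j, 0 ≤ A i j) (hB : ∀ i j, 0 ≤ B i j) :
    ∀ i j, 0 ≤ (A + B) i j := fun i j => by
  rw [Matrix.add_apply]
  exact add_nonneg (hA i j) (hB i j)

omit [Fintype n] [DecidableEq n] in
/-- Nonnegative multiples of entrywise nonnegative matrices are entrywise nonnegative. [folklore] -/
theorem entrywise_nonneg_smul {A : Matrix n n ℂ} (hA : ∀ i j, 0 ≤ A i j) {c : ℂ} (hc : 0 ≤ c) :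
    ∀ i j, 0 ≤ (c • A) i j := fun i j => by
  rw [Matrix.smul_apply, smul_eq_mul]
  exact mul_nonneg hc (hA i j)

omit [Fintype n] [DecidableEq n] in
/-- Finite sums of entrywise nonnegative matrices are entrywise nonnegative. [folklore] -/
theorem entrywise_nonneg_sum {ι : Type*} (s : Finset ι) {A : ι → Matrix n n ℂ}
    (hA : ∀ k ∈ s, ∀ i j, 0 ≤ A k i j) : ∀ i j, 0 ≤ (∑ k ∈ s, A k) i j := fun i j => by
  rw [Matrix.sum_apply]
  exact Finset.sum_nonneg fun k hk => hA k hk i j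

omit [Fintype n] [DecidableEq n] in
/-- The zero matrix is entrywise nonnegative. [folklore] -/
theorem entrywise_nonneg_zero : ∀ i j, 0 ≤ (0 : Matrix n n ℂ) i j := fun _ _ => le_rfl

omit [Fintype n] in
/-- The identity matrix is entrywise nonnegative. [folklore] -/
theorem entrywise_nonneg_one : ∀ i j, 0 ≤ (1 : Matrix n n ℂ) i j := fun i j => by
  rw [Matrix.one_apply]
  split_ifs
  · exact zero_le_one
  · exact le_rfl

/-- Powers of an entrywise nonnegative matrix are entrywise nonnegative. [folklore] -/
theorem entrywise_nonneg_pow {A : Matrix n n ℂ} (hA : ∀ i j, 0 ≤ A i j) :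
    ∀ (k : ℕ) (i j), 0 ≤ (A ^ k) i j
  | 0 => by
    rw [pow_zero]
    exact entrywise_nonneg_one
  | k + 1 => by
    rw [pow_succ]
    exact entrywise_nonneg_mul (entrywise_nonneg_pow hA k) hA

/-- **The exponential of an entrywise nonnegative matrix is entrywise nonnegative** (all Taylor
coefficients of `exp` are nonnegative). [folklore] -/
theorem entrywise_nonneg_exp {A : Matrix n n ℂ} (hA : ∀ i j, 0 ≤ A i j) :
    ∀ i j, 0 ≤ (NormedSpace.exp A) i j := fun i j => by
  open scoped Matrix.Norms.Operator in
  have h := NormedSpace.exp_series_hasSum_exp' (𝕂 := ℂ) A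
  have hij : HasSum (fun k : ℕ => ((k.factorial⁻¹ : ℂ) • A ^ k) i j) ((NormedSpace.exp A) i j) :=
    (h.map (Matrix.entryLinearMap ℂ ℂ i j) (by fun_prop) :)
  refine hij.nonneg fun k => ?_
  rw [Matrix.smul_apply, smul_eq_mul]
  refine mul_nonneg ?_ (entrywise_nonneg_pow hA k i j)
  rw [← Complex.ofReal_natCast, ← Complex.ofReal_inv]
  exact Complex.zero_le_real.mpr (inv_nonneg.mpr (Nat.cast_nonneg _))

omit [DecidableEq n] in
/-- The trace of an entrywise nonnegative matrix is nonnegative. [folklore] -/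
theorem trace_nonneg_of_entrywise_nonneg {A : Matrix n n ℂ} (hA : ∀ i j, 0 ≤ A i j) :
    0 ≤ A.trace :=
  Finset.sum_nonneg fun i _ => hA i i

omit [DecidableEq n] in
/-- Unfolding a doubly negated product: `(-A) * (-B) = A * B`, so a product of two entrywise
nonpositive matrices is entrywise nonnegative. [folklore] -/
theorem entrywise_nonneg_mul_of_nonpos {A B : Matrix n n ℂ} (hA : ∀ i j, 0 ≤ (-A) i j)
    (hB : ∀ i j, 0 ≤ (-B) i j) : ∀ i j, 0 ≤ (A * B) i j := by
  rw [← neg_mul_neg]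
  exact entrywise_nonneg_mul hA hB

end EntrywiseNonneg

/-! ### The algebra of the doubled system; BLU Lemmas 7 and 6 -/

section Doubling

variable {Λ : Type*} [Fintype Λ] [DecidableEq Λ]

/-- `(a ⊗ 𝟙)(𝟙 ⊗ b) = a ⊗ b`. [cite: BenassiLeesUeltschi2016, §3 (product space)] -/
theorem dblLeft_mul_dblRight (a b : Op Λ 2) :
    dblLeft Λ a * dblRight Λ b = reindex (dblEquiv Λ) (dblEquiv Λ) (a ⊗ₖ b) := by
  have h := map_mul (reindexAlgEquiv ℂ ℂ (dblEquiv Λ)) (a ⊗ₖ (1 : Op Λ 2)) ((1 : Op Λ 2) ⊗ₖ b)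
  simp only [coe_reindexAlgEquiv, ← mul_kronecker_mul, Matrix.mul_one, Matrix.one_mul] at h
  rw [dblLeft_apply, dblRight_apply, ← h]

/-- `(𝟙 ⊗ b)(a ⊗ 𝟙) = a ⊗ b`: the two embeddings commute. [cite: BenassiLeesUeltschi2016, §3 (product space)] -/
theorem dblRight_mul_dblLeft (a b : Op Λ 2) :
    dblRight Λ b * dblLeft Λ a = reindex (dblEquiv Λ) (dblEquiv Λ) (a ⊗ₖ b) := by
  have h := map_mul (reindexAlgEquiv ℂ ℂ (dblEquiv Λ)) ((1 : Op Λ 2) ⊗ₖ b) (a ⊗ₖ (1 : Op Λ 2))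
  simp only [coe_reindexAlgEquiv, ← mul_kronecker_mul, Matrix.mul_one, Matrix.one_mul] at h
  rw [dblLeft_apply, dblRight_apply, ← h]

/-- The two embeddings commute. [cite: BenassiLeesUeltschi2016, §3 (product space)] -/
theorem commute_dblLeft_dblRight (a b : Op Λ 2) : Commute (dblLeft Λ a) (dblRight Λ b) := by
  rw [Commute, SemiconjBy, dblLeft_mul_dblRight, dblRight_mul_dblLeft]

/-- Products of simple tensors: `(a ⊗ b)(c ⊗ d) = ac ⊗ bd`. [cite: BenassiLeesUeltschi2016, §3 (product space)] -/
theorem dblLR_mul_dblLR (a b c d : Op Λ 2) :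
    dblLeft Λ a * dblRight Λ b * (dblLeft Λ c * dblRight Λ d) =
      dblLeft Λ (a * c) * dblRight Λ (b * d) := by
  rw [map_mul, map_mul, mul_assoc, ← mul_assoc (dblRight Λ b), dblRight_mul_dblLeft,
    ← dblLeft_mul_dblRight]
  simp only [mul_assoc]

omit [DecidableEq Λ] in
/-- The trace is invariant under reindexing (both indices along the same equivalence). [folklore] -/
theorem trace_reindex_equiv {m m' : Type*} [Fintype m] [Fintype m'] (e : m ≃ m') (M : Matrix m m ℂ) :
    (reindex e e M).trace = M.trace := by
  simp only [Matrix.trace, Matrix.diag, reindex_apply, submatrix_apply]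
  exact e.symm.sum_comp (fun i => M i i)

/-- **`Tr_{𝓗⊗𝓗} (a ⊗ b) = Tr a · Tr b`.** [cite: BenassiLeesUeltschi2016, §3 (product space)] -/
theorem trace_dblLeft_mul_dblRight (a b : Op Λ 2) :
    (dblLeft Λ a * dblRight Λ b).trace = a.trace * b.trace := by
  rw [dblLeft_mul_dblRight, trace_reindex_equiv, trace_kronecker]

/-- The left embedding commutes with the matrix exponential: `e^{a} ⊗ 𝟙 = e^{a ⊗ 𝟙}` (a
continuous algebra homomorphism of finite-dimensional algebras). [folklore] -/
theorem dblLeft_exp (a : Op Λ 2) :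
    dblLeft Λ (NormedSpace.exp a) = NormedSpace.exp (dblLeft Λ a) := by
  have hf : Continuous (dblLeft Λ) := (dblLeft Λ).toLinearMap.continuous_of_finiteDimensional
  open scoped Matrix.Norms.Operator in exact NormedSpace.map_exp (dblLeft Λ) hf a

/-- The right embedding commutes with the matrix exponential: `𝟙 ⊗ e^{a} = e^{𝟙 ⊗ a}`. [folklore] -/
theorem dblRight_exp (a : Op Λ 2) :
    dblRight Λ (NormedSpace.exp a) = NormedSpace.exp (dblRight Λ a) := by
  have hf : Continuous (dblRight Λ) := (dblRight Λ).toLinearMap.continuous_of_finiteDimensional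
  open scoped Matrix.Norms.Operator in exact NormedSpace.map_exp (dblRight Λ) hf a

/-- **`e^{a} ⊗ e^{a'} = e^{a ⊗ 𝟙 + 𝟙 ⊗ a'}`** (the summands commute). [cite: BenassiLeesUeltschi2016, §3 (product space)] -/
theorem dblLeft_exp_mul_dblRight_exp (a a' : Op Λ 2) :
    dblLeft Λ (NormedSpace.exp a) * dblRight Λ (NormedSpace.exp a') =
      NormedSpace.exp (dblLeft Λ a + dblRight Λ a') := by
  rw [dblLeft_exp, dblRight_exp, Matrix.exp_add_of_commute _ _ (commute_dblLeft_dblRight a a')]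

/-- **BLU Lemma 7, `+` case**: `(ab)₊ = ½ a₊ b₊ + ½ a₋ b₋`. The cross terms cancel identically,
no commutation is needed. [cite: BenassiLeesUeltschi2016, Lemma 7] -/
theorem dblPlus_mul (a b : Op Λ 2) :
    dblPlus Λ (a * b) =
      (2⁻¹ : ℂ) • (dblPlus Λ a * dblPlus Λ b) + (2⁻¹ : ℂ) • (dblMinus Λ a * dblMinus Λ b) := by
  simp only [dblPlus_apply, dblMinus_apply, map_mul]
  rw [← smul_add]
  have h2 : (dblLeft Λ a + dblRight Λ a) * (dblLeft Λ b + dblRight Λ b) +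
      (dblLeft Λ a - dblRight Λ a) * (dblLeft Λ b - dblRight Λ b) =
      (2 : ℂ) • (dblLeft Λ a * dblLeft Λ b + dblRight Λ a * dblRight Λ b) := by
    rw [two_smul]
    noncomm_ring
  rw [h2, smul_smul, inv_mul_cancel₀ two_ne_zero, one_smul]

/-- **BLU Lemma 7, `-` case**: `(ab)₋ = ½ a₊ b₋ + ½ a₋ b₊`. [cite: BenassiLeesUeltschi2016, Lemma 7] -/
theorem dblMinus_mul (a b : Op Λ 2) :
    dblMinus Λ (a * b) =
      (2⁻¹ : ℂ) • (dblPlus Λ a * dblMinus Λ b) + (2⁻¹ : ℂ) • (dblMinus Λ a * dblPlus Λ b) := by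
  simp only [dblPlus_apply, dblMinus_apply, map_mul]
  rw [← smul_add]
  have h2 : (dblLeft Λ a + dblRight Λ a) * (dblLeft Λ b - dblRight Λ b) +
      (dblLeft Λ a - dblRight Λ a) * (dblLeft Λ b + dblRight Λ b) =
      (2 : ℂ) • (dblLeft Λ a * dblLeft Λ b - dblRight Λ a * dblRight Λ b) := by
    rw [two_smul]
    noncomm_ring
  rw [h2, smul_smul, inv_mul_cancel₀ two_ne_zero, one_smul]

/-- **BLU Lemma 6 in trace form.** For all `a, b, W, W'`:
`Tr[a₋ (W ⊗ W) b₋ (W' ⊗ W')] = 2 (Tr(a W b W') Tr(W W') - Tr(a W W') Tr(W b W'))`; with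
`W = e^{-sβH}`, `W' = e^{-(1-s)βH}` the right side is `2 Z² (⟨a ; b⟩_s - ⟨a⟩⟨b⟩)`.
[cite: BenassiLeesUeltschi2016, Lemma 6] -/
theorem trace_dblMinus_mul_mul_dblMinus_mul (a b W W' : Op Λ 2) :
    (dblMinus Λ a * (dblLeft Λ W * dblRight Λ W) * dblMinus Λ b *
        (dblLeft Λ W' * dblRight Λ W')).trace =
      2 * ((a * W * b * W').trace * (W * W').trace - (a * W * W').trace * (W * b * W').trace) := by
  have ha : dblMinus Λ a = dblLeft Λ a * dblRight Λ 1 - dblLeft Λ 1 * dblRight Λ a := by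
    rw [dblMinus_apply, map_one, map_one, mul_one, one_mul]
  have hb : dblMinus Λ b = dblLeft Λ b * dblRight Λ 1 - dblLeft Λ 1 * dblRight Λ b := by
    rw [dblMinus_apply, map_one, map_one, mul_one, one_mul]
  rw [ha, hb]
  simp only [sub_mul, mul_sub, dblLR_mul_dblLR, Matrix.one_mul, Matrix.mul_one, trace_sub,
    trace_dblLeft_mul_dblRight]
  ring

end Doubling

/-! ### BLU Lemma 8: explicit `4 × 4` computations -/

section Basis

/-- The doubled single-site matrix `m ⊗ m'` in the `Fin 4` indexing `(i, j) ↦ 2 i + j`.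
[folklore] -/
theorem reindex_dblFin_kronecker (m m' : Matrix (Fin 2) (Fin 2) ℂ) :
    reindex dblFin dblFin (m ⊗ₖ m') =
      !![m 0 0 * m' 0 0, m 0 0 * m' 0 1, m 0 1 * m' 0 0, m 0 1 * m' 0 1;
         m 0 0 * m' 1 0, m 0 0 * m' 1 1, m 0 1 * m' 1 0, m 0 1 * m' 1 1;
         m 1 0 * m' 0 0, m 1 0 * m' 0 1, m 1 1 * m' 0 0, m 1 1 * m' 0 1;
         m 1 0 * m' 1 0, m 1 0 * m' 1 1, m 1 1 * m' 1 0, m 1 1 * m' 1 1] := by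
  ext k l
  fin_cases k <;> fin_cases l <;> rfl

/-- Reindexing is additive. [folklore] -/
theorem reindex_dblFin_add (A B : Matrix (Fin 2 × Fin 2) (Fin 2 × Fin 2) ℂ) :
    reindex dblFin dblFin (A + B) = reindex dblFin dblFin A + reindex dblFin dblFin B := rfl

/-- Reindexing commutes with subtraction. [folklore] -/
theorem reindex_dblFin_sub (A B : Matrix (Fin 2 × Fin 2) (Fin 2 × Fin 2) ℂ) :
    reindex dblFin dblFin (A - B) = reindex dblFin dblFin A - reindex dblFin dblFin B := rfl

/-- `σˣ₊ = σˣ ⊗ 𝟙 + 𝟙 ⊗ σˣ` on `ℂ⁴`. [cite: BenassiLeesUeltschi2016, §3 (proof of Lemma 8)] -/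
theorem pauliX_dblPlus : reindex dblFin dblFin
      (spinHalfPauli 0 ⊗ₖ (1 : Matrix (Fin 2) (Fin 2) ℂ) + 1 ⊗ₖ spinHalfPauli 0) =
    !![0, 1, 1, 0; 1, 0, 0, 1; 1, 0, 0, 1; 0, 1, 1, 0] := by
  rw [reindex_dblFin_add, reindex_dblFin_kronecker, reindex_dblFin_kronecker]
  ext k l
  fin_cases k <;> fin_cases l <;> simp [spinHalfPauli, one_apply]

/-- `σˣ₋ = σˣ ⊗ 𝟙 - 𝟙 ⊗ σˣ` on `ℂ⁴`. [cite: BenassiLeesUeltschi2016, §3 (proof of Lemma 8)] -/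
theorem pauliX_dblMinus : reindex dblFin dblFin
      (spinHalfPauli 0 ⊗ₖ (1 : Matrix (Fin 2) (Fin 2) ℂ) - 1 ⊗ₖ spinHalfPauli 0) =
    !![0, -1, 1, 0; -1, 0, 0, 1; 1, 0, 0, -1; 0, 1, -1, 0] := by
  rw [reindex_dblFin_sub, reindex_dblFin_kronecker, reindex_dblFin_kronecker]
  ext k l
  fin_cases k <;> fin_cases l <;> simp [spinHalfPauli, one_apply]

/-- `σʸ₊ = σʸ ⊗ 𝟙 + 𝟙 ⊗ σʸ` on `ℂ⁴`. [cite: BenassiLeesUeltschi2016, §3 (proof of Lemma 8)] -/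
theorem pauliY_dblPlus : reindex dblFin dblFin
      (spinHalfPauli 1 ⊗ₖ (1 : Matrix (Fin 2) (Fin 2) ℂ) + 1 ⊗ₖ spinHalfPauli 1) =
    !![0, -I, -I, 0; I, 0, 0, -I; I, 0, 0, -I; 0, I, I, 0] := by
  rw [reindex_dblFin_add, reindex_dblFin_kronecker, reindex_dblFin_kronecker]
  ext k l
  fin_cases k <;> fin_cases l <;> simp [spinHalfPauli, one_apply]

/-- `σʸ₋ = σʸ ⊗ 𝟙 - 𝟙 ⊗ σʸ` on `ℂ⁴`. [cite: BenassiLeesUeltschi2016, §3 (proof of Lemma 8)] -/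
theorem pauliY_dblMinus : reindex dblFin dblFin
      (spinHalfPauli 1 ⊗ₖ (1 : Matrix (Fin 2) (Fin 2) ℂ) - 1 ⊗ₖ spinHalfPauli 1) =
    !![0, I, -I, 0; -I, 0, 0, -I; I, 0, 0, I; 0, I, -I, 0] := by
  rw [reindex_dblFin_sub, reindex_dblFin_kronecker, reindex_dblFin_kronecker]
  ext k l
  fin_cases k <;> fin_cases l <;> simp [spinHalfPauli, one_apply]

/-- **BLU Lemma 8, `S¹₊`**: in the good basis `σˣ₊` has the nonnegative entries `2` at
`(p₊, q₊), (q₊, p₊)`. [cite: BenassiLeesUeltschi2016, Lemma 8] -/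
theorem bluBasisAux_mul_pauliX_dblPlus :
    bluBasisAux * !![0, 1, 1, 0; 1, 0, 0, 1; 1, 0, 0, 1; 0, 1, 1, (0 : ℂ)] =
      !![0, 2, 0, 0; 2, 0, 0, 0; 0, 0, 0, 0; 0, 0, 0, 0] * bluBasisAux := by
  rw [bluBasisAux]
  ext k l
  fin_cases k <;> fin_cases l <;> simp [Matrix.mul_apply, Fin.sum_univ_four] <;> ring

/-- **BLU Lemma 8, `S¹₋`**: in the good basis `σˣ₋` has the nonnegative entries `2` at
`(p₋, q₋), (q₋, p₋)`. [cite: BenassiLeesUeltschi2016, Lemma 8] -/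
theorem bluBasisAux_mul_pauliX_dblMinus :
    bluBasisAux * !![0, -1, 1, 0; -1, 0, 0, 1; 1, 0, 0, -1; 0, 1, -1, (0 : ℂ)] =
      !![0, 0, 0, 0; 0, 0, 0, 0; 0, 0, 0, 2; 0, 0, 2, 0] * bluBasisAux := by
  rw [bluBasisAux]
  ext k l
  fin_cases k <;> fin_cases l <;> simp [Matrix.mul_apply, Fin.sum_univ_four] <;> ring

/-- **BLU Lemma 8, `S³₊` (here `σʸ₊`)**: nonnegative entries `2` at `(p₊, p₋), (p₋, p₊)`.
[cite: BenassiLeesUeltschi2016, Lemma 8] -/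
theorem bluBasisAux_mul_pauliY_dblPlus :
    bluBasisAux * !![0, -I, -I, 0; I, 0, 0, -I; I, 0, 0, -I; 0, I, I, 0] =
      !![0, 0, 2, 0; 0, 0, 0, 0; 2, 0, 0, 0; 0, 0, 0, 0] * bluBasisAux := by
  rw [bluBasisAux]
  ext k l
  fin_cases k <;> fin_cases l <;> simp [Matrix.mul_apply, Fin.sum_univ_four] <;> ring

/-- **BLU Lemma 8, `S³₋` (here `σʸ₋`)**: NONPOSITIVE entries `-2` at `(q₊, q₋), (q₋, q₊)`.
[cite: BenassiLeesUeltschi2016, Lemma 8] -/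
theorem bluBasisAux_mul_pauliY_dblMinus :
    bluBasisAux * !![0, I, -I, 0; -I, 0, 0, -I; I, 0, 0, I; 0, I, -I, 0] =
      !![0, 0, 0, 0; 0, 0, 0, -2; 0, 0, 0, 0; 0, -2, 0, 0] * bluBasisAux := by
  rw [bluBasisAux]
  ext k l
  fin_cases k <;> fin_cases l <;> simp [Matrix.mul_apply, Fin.sum_univ_four] <;> ring

/-- `0 ≤ ½` in the order of `ℂ`. [folklore] -/
theorem one_half_nonneg_complex : (0 : ℂ) ≤ 1 / 2 := by
  have h : ((1 / 2 : ℝ) : ℂ) = 1 / 2 := by push_cast; ring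
  rw [← h]
  exact Complex.zero_le_real.mpr (by norm_num)

/-- Conjugation by `U₀` from an intertwining relation for `bluBasisAux`:
`√2 U₀ M = N √2 U₀ ⟹ U₀ M U₀† = N`. [folklore] -/
theorem bluBasis_conj_eq {M N : Matrix (Fin 4) (Fin 4) ℂ} (h : bluBasisAux * M = N * bluBasisAux) :
    bluBasis * M * bluBasisᴴ = N := by
  rw [bluBasis, conjTranspose_smul, Matrix.smul_mul, Matrix.smul_mul, Matrix.mul_smul, smul_smul,
    h, Matrix.mul_assoc, bluBasisAux_mul_conjTranspose, Matrix.mul_smul, Matrix.mul_one, smul_smul,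
    Complex.star_def, Complex.conj_ofReal, sqrt_two_inv_mul_self_mul_two, one_smul]

end Basis

/-! ### The good basis of the doubled spin system: base cases of BLU Lemma 8 -/

section GoodBasis

variable {Λ : Type*} [Fintype Λ] [DecidableEq Λ]

/-- **The doubled system is a four-state spin system, site by site**: for single-site matrices
`m, m'` at the same site `x`, `(m)_x ⊗ (m')_x` is the single-site operator `m ⊗ m'` of the doubled
system. [cite: BenassiLeesUeltschi2016, §3 (product space)] -/
theorem reindex_dblEquiv_onSite_kronecker_onSite (x : Λ) (m m' : Matrix (Fin 2) (Fin 2) ℂ) :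
    reindex (dblEquiv Λ) (dblEquiv Λ) ((onSite x m : Op Λ 2) ⊗ₖ (onSite x m' : Op Λ 2)) =
      (onSite x (reindex dblFin dblFin (m ⊗ₖ m')) : Op Λ 4) := by
  ext τ τ'
  simp only [reindex_apply, submatrix_apply, kroneckerMap_apply, dblEquiv_symm_apply, onSite_apply]
  by_cases h : ∀ y, y ≠ x → τ y = τ' y
  · have h1 : ∀ y, y ≠ x → (dblFin.symm (τ y)).1 = (dblFin.symm (τ' y)).1 :=
      fun y hy => by rw [h y hy]
    have h2 : ∀ y, y ≠ x → (dblFin.symm (τ y)).2 = (dblFin.symm (τ' y)).2 :=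
      fun y hy => by rw [h y hy]
    rw [if_pos h, if_pos h1, if_pos h2]
  · rw [if_neg h]
    push Not at h
    obtain ⟨y, hy, hne⟩ := h
    have hor : (dblFin.symm (τ y)).1 ≠ (dblFin.symm (τ' y)).1 ∨
        (dblFin.symm (τ y)).2 ≠ (dblFin.symm (τ' y)).2 := by
      by_contra hc
      push Not at hc
      exact hne (dblFin.symm.injective (Prod.ext hc.1 hc.2))
    rcases hor with hne1 | hne2
    · have h0 : (if ∀ y, y ≠ x → (dblFin.symm (τ y)).1 = (dblFin.symm (τ' y)).1 then
          m (dblFin.symm (τ x)).1 (dblFin.symm (τ' x)).1 else (0 : ℂ)) = 0 :=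
        if_neg fun h1 => hne1 (h1 y hy)
      rw [h0, zero_mul]
    · have h0 : (if ∀ y, y ≠ x → (dblFin.symm (τ y)).2 = (dblFin.symm (τ' y)).2 then
          m' (dblFin.symm (τ x)).2 (dblFin.symm (τ' x)).2 else (0 : ℂ)) = 0 :=
        if_neg fun h2 => hne2 (h2 y hy)
      rw [h0, mul_zero]

/-- `(m)_x ⊗ 𝟙 = (m ⊗ 𝟙₂)_x` in the doubled system. [cite: BenassiLeesUeltschi2016, §3 (product space)] -/
theorem dblLeft_onSite (x : Λ) (m : Matrix (Fin 2) (Fin 2) ℂ) :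
    dblLeft Λ (onSite x m) = onSite x (reindex dblFin dblFin (m ⊗ₖ 1)) := by
  rw [dblLeft_apply, ← reindex_dblEquiv_onSite_kronecker_onSite, onSite_one']

/-- `𝟙 ⊗ (m)_x = (𝟙₂ ⊗ m)_x` in the doubled system. [cite: BenassiLeesUeltschi2016, §3 (product space)] -/
theorem dblRight_onSite (x : Λ) (m : Matrix (Fin 2) (Fin 2) ℂ) :
    dblRight Λ (onSite x m) = onSite x (reindex dblFin dblFin (1 ⊗ₖ m)) := by
  rw [dblRight_apply, ← reindex_dblEquiv_onSite_kronecker_onSite, onSite_one']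

/-- `((m)_x)₊ = (m ⊗ 𝟙 + 𝟙 ⊗ m)_x`. [cite: BenassiLeesUeltschi2016, §3] -/
theorem dblPlus_onSite (x : Λ) (m : Matrix (Fin 2) (Fin 2) ℂ) :
    dblPlus Λ (onSite x m) = onSite x (reindex dblFin dblFin (m ⊗ₖ 1 + 1 ⊗ₖ m)) := by
  rw [dblPlus_apply, dblLeft_onSite, dblRight_onSite, ← onSite_add', reindex_dblFin_add]

/-- `((m)_x)₋ = (m ⊗ 𝟙 - 𝟙 ⊗ m)_x`. [cite: BenassiLeesUeltschi2016, §3] -/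
theorem dblMinus_onSite (x : Λ) (m : Matrix (Fin 2) (Fin 2) ℂ) :
    dblMinus Λ (onSite x m) = onSite x (reindex dblFin dblFin (m ⊗ₖ 1 - 1 ⊗ₖ m)) := by
  rw [dblMinus_apply, dblLeft_onSite, dblRight_onSite, ← onSite_sub', reindex_dblFin_sub]

/-- Conjugation by the good basis preserves the trace. [folklore] -/
theorem trace_ginibreConj (X : Op Λ 4) : (ginibreConj Λ X).trace = X.trace := by
  rw [ginibreConj_apply, trace_mul_cycle, ginibreU_conjTranspose_mul, Matrix.one_mul]

/-- Conjugation by the good basis commutes with the exponential: `U e^{X} U† = e^{U X U†}`.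
[folklore] -/
theorem ginibreConj_exp (X : Op Λ 4) :
    ginibreConj Λ (NormedSpace.exp X) = NormedSpace.exp (ginibreConj Λ X) := by
  have hf : Continuous (ginibreConj Λ) :=
    (ginibreConj Λ).toLinearMap.continuous_of_finiteDimensional
  open scoped Matrix.Norms.Operator in exact NormedSpace.map_exp (ginibreConj Λ) hf X

/-- `U (M)_x U† = (U₀ M U₀†)_x` for single-site operators of the doubled system.
[cite: BenassiLeesUeltschi2016, Lemma 8] -/
theorem ginibreConj_onSite (x : Λ) (M : Matrix (Fin 4) (Fin 4) ℂ) :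
    ginibreConj Λ (onSite x M) = onSite x (bluBasis * M * bluBasisᴴ) :=
  ginibreU_conj_onSite x M

/-- A single-site operator with entrywise nonnegative site matrix is entrywise nonnegative. [folklore] -/
theorem entrywise_nonneg_onSite {q : ℕ} (x : Λ) {M : Matrix (Fin q) (Fin q) ℂ}
    (hM : ∀ i j, 0 ≤ M i j) : ∀ σ τ, 0 ≤ (onSite x M : Op Λ q) σ τ := fun σ τ => by
  rw [onSite_apply]
  split_ifs
  · exact hM _ _
  · exact le_rfl

/-- **Base case `S¹₊ ≥ 0`** (tree direction `0`): `U (Sˣ_x)₊ U†` is entrywise nonnegative.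
[cite: BenassiLeesUeltschi2016, Lemma 8] -/
theorem entrywise_nonneg_ginibreConj_dblPlus_siteSpin_zero (x : Λ) :
    ∀ i j, 0 ≤ ginibreConj Λ (dblPlus Λ (siteSpin 1 x 0)) i j := by
  have h : ginibreConj Λ (dblPlus Λ (siteSpin 1 x 0)) =
      (1 / 2 : ℂ) • onSite x !![0, 2, 0, 0; 2, 0, 0, 0; 0, 0, 0, 0; 0, 0, 0, 0] := by
    rw [siteSpin, spinVec_one_eq_half_spinHalfPauli, onSite_smul', map_smul, map_smul,
      dblPlus_onSite, pauliX_dblPlus, ginibreConj_onSite,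
      bluBasis_conj_eq bluBasisAux_mul_pauliX_dblPlus]
  rw [h]
  refine entrywise_nonneg_smul (entrywise_nonneg_onSite x fun i j => ?_) one_half_nonneg_complex
  fin_cases i <;> fin_cases j <;> simp

/-- **Base case `S¹₋ ≥ 0`** (tree direction `0`): `U (Sˣ_x)₋ U†` is entrywise nonnegative.
[cite: BenassiLeesUeltschi2016, Lemma 8] -/
theorem entrywise_nonneg_ginibreConj_dblMinus_siteSpin_zero (x : Λ) :
    ∀ i j, 0 ≤ ginibreConj Λ (dblMinus Λ (siteSpin 1 x 0)) i j := by
  have h : ginibreConj Λ (dblMinus Λ (siteSpin 1 x 0)) =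
      (1 / 2 : ℂ) • onSite x !![0, 0, 0, 0; 0, 0, 0, 0; 0, 0, 0, 2; 0, 0, 2, 0] := by
    rw [siteSpin, spinVec_one_eq_half_spinHalfPauli, onSite_smul', map_smul, map_smul,
      dblMinus_onSite, pauliX_dblMinus, ginibreConj_onSite,
      bluBasis_conj_eq bluBasisAux_mul_pauliX_dblMinus]
  rw [h]
  refine entrywise_nonneg_smul (entrywise_nonneg_onSite x fun i j => ?_) one_half_nonneg_complex
  fin_cases i <;> fin_cases j <;> simp

/-- **Base case `S²₊ ≥ 0`** (tree direction `1`, BLU's `S³₊` after their rotation):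
`U (Sʸ_x)₊ U†` is entrywise nonnegative. [cite: BenassiLeesUeltschi2016, Lemma 8] -/
theorem entrywise_nonneg_ginibreConj_dblPlus_siteSpin_one (x : Λ) :
    ∀ i j, 0 ≤ ginibreConj Λ (dblPlus Λ (siteSpin 1 x 1)) i j := by
  have h : ginibreConj Λ (dblPlus Λ (siteSpin 1 x 1)) =
      (1 / 2 : ℂ) • onSite x !![0, 0, 2, 0; 0, 0, 0, 0; 2, 0, 0, 0; 0, 0, 0, 0] := by
    rw [siteSpin, spinVec_one_eq_half_spinHalfPauli, onSite_smul', map_smul, map_smul,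
      dblPlus_onSite, pauliY_dblPlus, ginibreConj_onSite,
      bluBasis_conj_eq bluBasisAux_mul_pauliY_dblPlus]
  rw [h]
  refine entrywise_nonneg_smul (entrywise_nonneg_onSite x fun i j => ?_) one_half_nonneg_complex
  fin_cases i <;> fin_cases j <;> simp

/-- **Base case `S²₋ ≤ 0`** (tree direction `1`, BLU's `-S³₋ ≥ 0`): `-U (Sʸ_x)₋ U†` is
entrywise nonnegative. [cite: BenassiLeesUeltschi2016, Lemma 8] -/
theorem entrywise_nonneg_neg_ginibreConj_dblMinus_siteSpin_one (x : Λ) :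
    ∀ i j, 0 ≤ (-ginibreConj Λ (dblMinus Λ (siteSpin 1 x 1))) i j := by
  have h : -ginibreConj Λ (dblMinus Λ (siteSpin 1 x 1)) =
      (1 / 2 : ℂ) • onSite x !![0, 0, 0, 0; 0, 0, 0, 2; 0, 0, 0, 0; 0, 2, 0, 0] := by
    rw [siteSpin, spinVec_one_eq_half_spinHalfPauli, onSite_smul', map_smul, map_smul,
      dblMinus_onSite, pauliY_dblMinus, ginibreConj_onSite,
      bluBasis_conj_eq bluBasisAux_mul_pauliY_dblMinus, ← smul_neg, ← onSite_neg']
    congr 2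
    ext i j
    fin_cases i <;> fin_cases j <;> simp
  rw [h]
  refine entrywise_nonneg_smul (entrywise_nonneg_onSite x fun i j => ?_) one_half_nonneg_complex
  fin_cases i <;> fin_cases j <;> simp

end GoodBasis

/-! ### BLU Theorem 1 (fixed `s`): positivity of the doubled trace -/

section Positivity

variable {Λ : Type*} [Fintype Λ] [DecidableEq Λ]

/-- **The Ginibre–BLU positivity mechanism.** If `U A₊ U†`, `U a₋ U†`, `U b₋ U†` are entrywise
nonnegative, then for `W = e^{cA}`, `W' = e^{dA}` with `c, d ≥ 0`,
`Tr(a W b W') Tr(W W') - Tr(a W W') Tr(W b W') ≥ 0`: by BLU Lemma 6 twice this difference is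
`Tr[a₋ (W ⊗ W) b₋ (W' ⊗ W')] = Tr[U a₋ U† · e^{c U A₊ U†} · U b₋ U† · e^{d U A₊ U†}]`, the trace of
a product of entrywise nonnegative matrices. [cite: BenassiLeesUeltschi2016, §3 (proof of Thm. 1)] -/
theorem ginibre_trace_sub_nonneg {A a b : Op Λ 2}
    (hA : ∀ i j, 0 ≤ ginibreConj Λ (dblPlus Λ A) i j)
    (ha : ∀ i j, 0 ≤ ginibreConj Λ (dblMinus Λ a) i j)
    (hb : ∀ i j, 0 ≤ ginibreConj Λ (dblMinus Λ b) i j) {c d : ℂ} (hc : 0 ≤ c) (hd : 0 ≤ d) :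
    0 ≤ (a * NormedSpace.exp (c • A) * b * NormedSpace.exp (d • A)).trace *
          (NormedSpace.exp (c • A) * NormedSpace.exp (d • A)).trace -
        (a * NormedSpace.exp (c • A) * NormedSpace.exp (d • A)).trace *
          (NormedSpace.exp (c • A) * b * NormedSpace.exp (d • A)).trace := by
  set W := NormedSpace.exp (c • A) with hW
  set W' := NormedSpace.exp (d • A) with hW'
  have key := trace_dblMinus_mul_mul_dblMinus_mul (Λ := Λ) a b W W'
  -- the doubled Gibbs weights are exponentials of `c A₊`, `d A₊`
  have hWW : dblLeft Λ W * dblRight Λ W = NormedSpace.exp (c • dblPlus Λ A) := by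
    rw [hW, dblLeft_exp_mul_dblRight_exp, map_smul, map_smul, ← smul_add, dblPlus_apply]
  have hWW' : dblLeft Λ W' * dblRight Λ W' = NormedSpace.exp (d • dblPlus Λ A) := by
    rw [hW', dblLeft_exp_mul_dblRight_exp, map_smul, map_smul, ← smul_add, dblPlus_apply]
  -- positivity of the doubled trace in the good basis
  have hpos : 0 ≤ (dblMinus Λ a * (dblLeft Λ W * dblRight Λ W) * dblMinus Λ b *
      (dblLeft Λ W' * dblRight Λ W')).trace := by
    rw [← trace_ginibreConj, map_mul, map_mul, map_mul, hWW, hWW', ginibreConj_exp,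
      ginibreConj_exp, map_smul, map_smul]
    exact trace_nonneg_of_entrywise_nonneg
      (entrywise_nonneg_mul (entrywise_nonneg_mul (entrywise_nonneg_mul ha
        (entrywise_nonneg_exp (entrywise_nonneg_smul hA hc))) hb)
        (entrywise_nonneg_exp (entrywise_nonneg_smul hA hd)))
  rw [key] at hpos
  have h2 : (0 : ℂ) ≤ 2⁻¹ := by
    rw [← Complex.ofReal_ofNat, ← Complex.ofReal_inv]
    exact Complex.zero_le_real.mpr (by norm_num)
  have h := mul_nonneg h2 hpos
  rwa [inv_mul_cancel_left₀ two_ne_zero] at h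

end Positivity

/-! ### Ginibre's cone -/

section Cone

variable {Λ : Type*} [Fintype Λ] [DecidableEq Λ]

/-- `0 ≤ 2⁻¹` in the order of `ℂ`. [folklore] -/
theorem inv_two_nonneg_complex : (0 : ℂ) ≤ 2⁻¹ := by
  rw [← Complex.ofReal_ofNat, ← Complex.ofReal_inv]
  exact Complex.zero_le_real.mpr (by norm_num)

/-- Positivity in the good basis is preserved by sums (for any linear doubling map `F`, e.g.
`F = (·)₊` or `(·)₋`). [folklore] -/
theorem entrywise_nonneg_ginibreConj_map_sum (F : Op Λ 2 →ₗ[ℂ] Op Λ 4) {ι : Type*} (s : Finset ι)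
    {f : ι → Op Λ 2} (h : ∀ k ∈ s, ∀ i j, 0 ≤ ginibreConj Λ (F (f k)) i j) :
    ∀ i j, 0 ≤ ginibreConj Λ (F (∑ k ∈ s, f k)) i j := by
  rw [map_sum, map_sum]
  exact entrywise_nonneg_sum s h

/-- Positivity in the good basis is preserved by addition. [folklore] -/
theorem entrywise_nonneg_ginibreConj_map_add (F : Op Λ 2 →ₗ[ℂ] Op Λ 4) {a b : Op Λ 2}
    (ha : ∀ i j, 0 ≤ ginibreConj Λ (F a) i j) (hb : ∀ i j, 0 ≤ ginibreConj Λ (F b) i j) :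
    ∀ i j, 0 ≤ ginibreConj Λ (F (a + b)) i j := by
  rw [map_add, map_add]
  exact entrywise_nonneg_add ha hb

/-- Positivity in the good basis is preserved by nonnegative scalars. [folklore] -/
theorem entrywise_nonneg_ginibreConj_map_smul (F : Op Λ 2 →ₗ[ℂ] Op Λ 4) {a : Op Λ 2}
    (ha : ∀ i j, 0 ≤ ginibreConj Λ (F a) i j) {c : ℂ} (hc : 0 ≤ c) :
    ∀ i j, 0 ≤ ginibreConj Λ (F (c • a)) i j := by
  rw [map_smul, map_smul]
  exact entrywise_nonneg_smul ha hc

/-- **Ginibre's cone is multiplicative** (BLU Lemma 7): if `a₊, a₋, b₊, b₋` are entrywise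
nonnegative in the good basis then so are `(ab)₊ = ½(a₊b₊ + a₋b₋)` and `(ab)₋ = ½(a₊b₋ + a₋b₊)`.
[cite: BenassiLeesUeltschi2016, Lemma 7] -/
theorem ginibreCone_mul {a b : Op Λ 2}
    (ha : (∀ i j, 0 ≤ ginibreConj Λ (dblPlus Λ a) i j) ∧ ∀ i j, 0 ≤ ginibreConj Λ (dblMinus Λ a) i j)
    (hb : (∀ i j, 0 ≤ ginibreConj Λ (dblPlus Λ b) i j) ∧ ∀ i j, 0 ≤ ginibreConj Λ (dblMinus Λ b) i j) :
    (∀ i j, 0 ≤ ginibreConj Λ (dblPlus Λ (a * b)) i j) ∧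
      ∀ i j, 0 ≤ ginibreConj Λ (dblMinus Λ (a * b)) i j := by
  constructor
  · rw [dblPlus_mul, map_add, map_smul, map_smul, map_mul, map_mul]
    exact entrywise_nonneg_add
      (entrywise_nonneg_smul (entrywise_nonneg_mul ha.1 hb.1) inv_two_nonneg_complex)
      (entrywise_nonneg_smul (entrywise_nonneg_mul ha.2 hb.2) inv_two_nonneg_complex)
  · rw [dblMinus_mul, map_add, map_smul, map_smul, map_mul, map_mul]
    exact entrywise_nonneg_add
      (entrywise_nonneg_smul (entrywise_nonneg_mul ha.1 hb.2) inv_two_nonneg_complex)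
      (entrywise_nonneg_smul (entrywise_nonneg_mul ha.2 hb.1) inv_two_nonneg_complex)

/-- Ginibre's cone is closed under addition. [cite: BenassiLeesUeltschi2016, §3 (product space)] -/
theorem ginibreCone_add {a b : Op Λ 2}
    (ha : (∀ i j, 0 ≤ ginibreConj Λ (dblPlus Λ a) i j) ∧ ∀ i j, 0 ≤ ginibreConj Λ (dblMinus Λ a) i j)
    (hb : (∀ i j, 0 ≤ ginibreConj Λ (dblPlus Λ b) i j) ∧ ∀ i j, 0 ≤ ginibreConj Λ (dblMinus Λ b) i j) :
    (∀ i j, 0 ≤ ginibreConj Λ (dblPlus Λ (a + b)) i j) ∧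
      ∀ i j, 0 ≤ ginibreConj Λ (dblMinus Λ (a + b)) i j :=
  ⟨entrywise_nonneg_ginibreConj_map_add _ ha.1 hb.1, entrywise_nonneg_ginibreConj_map_add _ ha.2 hb.2⟩

/-- Ginibre's cone is closed under nonnegative scalars. [cite: BenassiLeesUeltschi2016, §3 (product space)] -/
theorem ginibreCone_smul {a : Op Λ 2}
    (ha : (∀ i j, 0 ≤ ginibreConj Λ (dblPlus Λ a) i j) ∧ ∀ i j, 0 ≤ ginibreConj Λ (dblMinus Λ a) i j)
    {c : ℂ} (hc : 0 ≤ c) :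
    (∀ i j, 0 ≤ ginibreConj Λ (dblPlus Λ (c • a)) i j) ∧
      ∀ i j, 0 ≤ ginibreConj Λ (dblMinus Λ (c • a)) i j :=
  ⟨entrywise_nonneg_ginibreConj_map_smul _ ha.1 hc, entrywise_nonneg_ginibreConj_map_smul _ ha.2 hc⟩

/-- Ginibre's cone is closed under finite sums. [cite: BenassiLeesUeltschi2016, §3 (product space)] -/
theorem ginibreCone_sum {ι : Type*} (s : Finset ι) {f : ι → Op Λ 2}
    (h : ∀ k ∈ s, (∀ i j, 0 ≤ ginibreConj Λ (dblPlus Λ (f k)) i j) ∧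
      ∀ i j, 0 ≤ ginibreConj Λ (dblMinus Λ (f k)) i j) :
    (∀ i j, 0 ≤ ginibreConj Λ (dblPlus Λ (∑ k ∈ s, f k)) i j) ∧
      ∀ i j, 0 ≤ ginibreConj Λ (dblMinus Λ (∑ k ∈ s, f k)) i j :=
  ⟨entrywise_nonneg_ginibreConj_map_sum _ s fun k hk => (h k hk).1,
    entrywise_nonneg_ginibreConj_map_sum _ s fun k hk => (h k hk).2⟩

/-- **The generators `Sˣ_x` lie in Ginibre's cone** (BLU Lemma 8, tree direction `0`).
[cite: BenassiLeesUeltschi2016, Lemma 8] -/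
theorem ginibreCone_siteSpin_zero (x : Λ) :
    (∀ i j, 0 ≤ ginibreConj Λ (dblPlus Λ (siteSpin 1 x 0)) i j) ∧
      ∀ i j, 0 ≤ ginibreConj Λ (dblMinus Λ (siteSpin 1 x 0)) i j :=
  ⟨entrywise_nonneg_ginibreConj_dblPlus_siteSpin_zero x,
    entrywise_nonneg_ginibreConj_dblMinus_siteSpin_zero x⟩

end Cone

end Literature.MathematicalPhysics.QuantumLattice
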